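import Summits.ResolutionOfSingularities.ResolutionOfSingularities.Theorems.RegularCurveLawAllMarkings
import Summits.ResolutionOfSingularities.ResolutionOfSingularities.Theorems.PolygonLawRoot
import Literature.AlgebraicGeometry.Resolution.BlowupSNC
import Literature.AlgebraicGeometry.Resolution.GenericPointStalkData
import Literature.AlgebraicGeometry.Resolution.CanonicalResolutionSmoothCentre
import HarnessLib

/-!
# CurveBranchKernel — «CurveBranchLaw» FILE A (decomp-res lens-4, g44): ADAPTER (§154), ISOLATION KILL + LAW R (§155), PIGEONHOLE LAW (§156)

# «CurveBranchLaw» (decomp-res lens-4, g44) — THE CURVE-LAW PORT `hC : MaxContactCut.CurveLawAll` OF THE ROOT RE-LOCATED EM-EXACTLY ONTO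
# EMBEDDED RESOLUTION OF THE HUGGED BRANCH, ITS DECIDED CELL KILLED HYPOTHESIS-FREE

OURS (D-0178 root decomposition cell, residual mode; minimal-counterexample lens, generation 44; critic ROW 242 WINDOW g44, door (R3-C)
STAGED, letter 236b).  THE EXTREMAL MOVE: a forced tower that hugs forever a one-dimensional germ `V(H) ∋ pt m` hugs one of its finitely many
MINIMAL PRIME components (pigeonhole on products of strict transforms, §156), i.e. an INTEGRAL CURVE germ; follow that branch: EITHER some
followed strict transform is a REGULAR one-dimensional germ — then (Matsumura 14.2) it is a regular curve FRAME hugged from that stage on,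
lens-6's descent `hugsTop_of_hugsRegCurveN` (Theorems/RegularCurveLawAllMarkings, ROW 128 — USED AS GLUE, not re-sold) makes the tower hug
the TOP curve of a frame, and a hugged top curve lies in the weight-`n` locus through the marked point, contradicting the tower axiom
`isolated` (the ISOLATION KILL, §155) — OR no followed strict transform is ever regular: the SINGULAR BRANCH cell, whose non-existence along
any branch is exactly embedded resolution of an integral curve germ by point blow-ups (`HuggedBranchResolution`, FILE B; Lipman 1978 §1,
Liu 2002 Prop. 8.1.26 + Lem. 9.2.32, Stacks 0BI5/0BIC, CJS2020 Ch. 2: KNOWN IN PRINT · UNDECIDED IN THE TREE).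
THIS FILE: §154 the adapter `toBranch` (a forced tower with a base root IS a lens-6 `SatelliteExitClasses.Branch` all of whose rounds are
point rounds; `strictIter` / `HugsGerm` transported definitionally); §155 `false_of_hugsTop` (ISOLATION KILL) and LAW R
`noTower_regularCurveHugging : NoTower n (P · ∧ RegularCurveHugging ·)` for EVERY class, weight, characteristic and field; §156 the stalk
operator `stOp σ E 𝔞 = ⋃ₙ (𝔞𝒪' : Eⁿ)` (monotone, super-multiplicative; = the followed stalk of a strict transform by the Literature formula
`stalkIdeal_strictTransformIdeal`), `prod_pow_le_strictIter` (a power of the product of the strict transforms of the minimal primes stays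
inside the strict transform), the PIGEONHOLE LAW `exists_hugsGerm_minimalPrime` (a hugged germ has a hugged minimal prime component,
`primeGerm` = the vanishing ideal sheaf of the closure of its generic point).
FILE B `Theorems/CurveBranchPort.lean`: prime curves (§156′), re-base (§157), Matsumura bridge (§158), the located residual F, the cells and the exact carve
`curveLawAll_iff_g44` (§159).  FILE C `Theorems/CurveBranchRoot.lean`: the (R1) re-lettering at weight 0 (§160) and the ROOT with 14
binders, position 2 re-typed `hC ↦ hF` (§161).
AI-written; AI review weaker than expert review.  `MaxContactCut.NoForcedTowers` (30253) is NOT proved; `MaxContactCut.CurveLawAll`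
(32207) is NOT proved — it is RE-TYPED em-exactly onto its located residual `HuggedBranchResolution` (KNOWN IN PRINT · UNDECIDED IN THE
TREE; discharging it from the Literature δ-engine is the announced g45 stage, not claimed here).  No named facts, no ports, no sorry.
-/

noncomputable section

set_option linter.dupNamespace false

open CategoryTheory CategoryTheory.Limits AlgebraicGeometry TopologicalSpace IsLocalRing
open Literature.AlgebraicGeometry.Resolution Scheme.IdealSheafData
open Summit.ResolutionOfSingularities.ResolutionOfSingularities.Theorems
open WeakOrderReduction ForcedTowerClasses DivergentTowerClasses MonomialTowerClasses
open HugDimensionClasses HugDimensionKernels SurfaceShadowClasses SurfaceShadowKernels AbsoluteContactClasses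

namespace Summit.ResolutionOfSingularities.ResolutionOfSingularities.Theorems.HugValuationCut

universe u

variable {k : Type} [Field k]

/-! ## ══ FILE A `Theorems/CurveBranchKernel.lean` (§154–§156: adapter, isolation kill + LAW R, stalk operator + pigeonhole) ══ -/

/-! ## §154 (g44 · ADAPTER) a forced tower with a base root IS a branch of lens-6 (`SatelliteExitClasses.Branch`) all of whose rounds are
point rounds -/

section Adapter

/-- **The branch of a forced tower** (every round a point round; structure maps `toRoot T i ≫ g`). [folklore] -/
def toBranch (T : ForcedTower) (g : T.St 0 ⟶ Spec (.of k)) (hB : IsBase (T.St 0) g) : SatelliteExitClasses.Branch k where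
  St := T.St
  str := fun i => toRoot T i ≫ g
  base := tower_isBase T g hB
  D := T.D
  pt := T.pt
  centre := T.centre
  π := T.π
  isClosed_pt := T.isClosed_pt
  centre_regular := T.centre_regular
  centre_adm := fun i => by
    rw [T.centre_support i, Set.singleton_subset_iff]
    exact (T.isolated i).1
  isBlowup := T.isBlowup
  str_comp := fun i => by rw [toRoot_succ, Category.assoc]
  transform_eq := T.transform_eq
  pt_map := T.pt_map
  kind := fun i => Or.inl (T.centre_support i)
  io := fun i₀ => ⟨i₀, le_rfl, T.centre_support i₀⟩

variable (T : ForcedTower) (g : T.St 0 ⟶ Spec (.of k)) (hB : IsBase (T.St 0) g)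

/-- The stages of the branch of a forced tower are the stages of the tower. -/
@[simp] theorem toBranch_St : (toBranch T g hB).St = T.St := rfl
/-- The marked ideals of the branch of a forced tower are those of the tower. -/
@[simp] theorem toBranch_D : (toBranch T g hB).D = T.D := rfl
/-- The marked points of the branch of a forced tower are those of the tower. -/
@[simp] theorem toBranch_pt : (toBranch T g hB).pt = T.pt := rfl
/-- The centres of the branch of a forced tower are those of the tower (the marked points). -/
@[simp] theorem toBranch_centre : (toBranch T g hB).centre = T.centre := rfl
/-- The blow-down maps of the branch of a forced tower are those of the tower. -/
@[simp] theorem toBranch_π : (toBranch T g hB).π = T.π := rfl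
/-- The structure maps of the branch of a forced tower are the root maps of the tower followed by the base map. -/
theorem toBranch_str (i : ℕ) : (toBranch T g hB).str i = toRoot T i ≫ g := rfl

/-- the iterated strict transforms along the branch of a tower ARE those along the tower (same stages, same centres). [folklore] -/
theorem strictIter_toBranch (m : ℕ) (H : (T.St m).IdealSheafData) :
    ∀ j, SatelliteExitClasses.strictIter (toBranch T g hB) m H j = DivergentTowerClasses.strictIter T m H j := by
  intro j
  induction j with
  | zero => rfl
  | succ j ih =>
    show strictTransformIdeal (T.π (m + j)) (T.centre (m + j)) (SatelliteExitClasses.strictIter (toBranch T g hB) m H j) = _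
    rw [ih]; rfl

/-- hugging along the tower ⟺ hugging along its branch. [folklore] -/
theorem hugsGerm_toBranch (m : ℕ) (H : (T.St m).IdealSheafData) :
    SatelliteExitClasses.HugsGerm (toBranch T g hB) m H ↔ DivergentTowerClasses.HugsGerm T m H := by
  unfold SatelliteExitClasses.HugsGerm DivergentTowerClasses.HugsGerm
  simp only [strictIter_toBranch]
  rfl

end Adapter

/-! ## §155 (g44 · THE ISOLATION KILL and LAW R) on a FORCED tower a hugged TOP CURVE contradicts the isolation axiom; hence NO forced
tower hugs a REGULAR curve germ — every weight, every characteristic, every field, every class (lens-6's descent `hugsTop_of_hugsRegCurveN`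
BY NAME + the kill) -/

section IsolationKill

/-- **In a local ring, an ideal with one-dimensional quotient lies in a prime DIFFERENT from the maximal ideal.** [folklore] -/
theorem exists_prime_le_ne_maximalIdeal_of_ringKrullDim_quotient_eq_one {R : Type*} [CommRing R] [IsLocalRing R] {I : Ideal R}
    (h : ringKrullDim (R ⧸ I) = 1) : ∃ P : Ideal R, P.IsPrime ∧ I ≤ P ∧ P ≠ maximalIdeal R := by
  have hpos : 0 < ringKrullDim (R ⧸ I) := by rw [h]; exact zero_lt_one
  obtain ⟨p₀, p₁, hlt⟩ := Order.krullDim_pos_iff.mp hpos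
  refine ⟨p₀.asIdeal.comap (Ideal.Quotient.mk I), Ideal.comap_isPrime _ _, ?_, ?_⟩
  · intro x hx
    rw [Ideal.mem_comap, Ideal.Quotient.eq_zero_iff_mem.mpr hx]
    exact zero_mem _
  · intro heq
    have h1 : p₀.asIdeal.comap (Ideal.Quotient.mk I) < p₁.asIdeal.comap (Ideal.Quotient.mk I) :=
      lt_of_le_of_ne (Ideal.comap_mono hlt.le) fun he =>
        (ne_of_lt hlt) (PrimeSpectrum.ext (Ideal.comap_injective_of_surjective _ Ideal.Quotient.mk_surjective he))
    have h2 : p₁.asIdeal.comap (Ideal.Quotient.mk I) ≤ maximalIdeal R :=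
      IsLocalRing.le_maximalIdeal (Ideal.IsPrime.ne_top (Ideal.comap_isPrime _ _))
    exact (lt_irrefl _) (lt_of_lt_of_le (heq ▸ h1) h2)

variable (T : ForcedTower) (g : T.St 0 ⟶ Spec (.of k)) (hB : IsBase (T.St 0) g)

/-- **THE ISOLATION KILL (NEW, tower-specific): the branch of a FORCED tower hugs NO top curve.**  A top curve `V(H) ∋ pt m` inside the top
locus `supp (D m)` with `dim 𝒪_{pt m}/H_{pt m} = 1` has a proper generisation `η ⤳ pt m`, `η ≠ pt m`, inside `supp H ⊆ supp (D m)` — every open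
neighbourhood of `pt m` contains `η`, contradicting the tower axiom `isolated m` («`pt m` is an isolated point of the top locus»). [NEW] -/
theorem false_of_hugsTop (h : (toBranch T g hB).HugsTop) : False := by
  obtain ⟨m, H, -, hsupp, hdim⟩ := h
  dsimp only [toBranch] at H hsupp hdim
  haveI := (tower_isLocallyNoetherian_isRegular T g hB m).1
  haveI : IsRegularLocalRing ((T.St m).presheaf.stalk (T.pt m)) := (tower_isBase T g hB m).isRegular _
  obtain ⟨P, hP, hIP, hPne⟩ := exists_prime_le_ne_maximalIdeal_of_ringKrullDim_quotient_eq_one hdim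
  let q : PrimeSpectrum ((T.St m).presheaf.stalk (T.pt m)) := ⟨P, hP⟩
  let η : T.St m := (T.St m).fromSpecStalk (T.pt m) q
  have hη : η ⤳ T.pt m := fromSpecStalk_specializes q
  have hPq : primeOfSpecializes hη = P := primeOfSpecializes_fromSpecStalk q
  have hηH : η ∈ (H.support : Set (T.St m)) := by
    refine (mem_support_iff_stalkIdeal_le H η).mpr ?_
    rw [← stalkIdeal_map_stalkSpecializes H hη]
    refine le_trans (Ideal.map_mono hIP) ?_
    rw [← hPq]; exact Ideal.map_comap_le
  have hηD : η ∈ (T.D m).support := hsupp hηH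
  obtain ⟨-, U, hU, hUS⟩ := T.isolated m
  have hηU : η ∈ (U : Set (T.St m)) := hη.mem_open U.2 hU
  have hηpt : η = T.pt m := hUS ⟨hηU, hηD⟩
  have key : ∀ (y : T.St m) (hy : y ⤳ T.pt m), y = T.pt m →
      primeOfSpecializes hy = maximalIdeal ((T.St m).presheaf.stalk (T.pt m)) := by
    rintro y hy rfl; exact primeOfSpecializes_refl _
  exact hPne (hPq ▸ key η hη hηpt)

/-- **REGULAR-CURVE HUGGING** (typed class, all markings): the tower hugs, from some stage `m` on, a curve germ `V(H) ∋ pt m` cut out at `pt m`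
by PART OF A REGULAR SYSTEM OF PARAMETERS (`H_{pt m} = (w_1, …, w_r)`, `r + 1 = dim 𝒪_{pt m}`) — lens-6's `CurveFrame`. -/
def RegularCurveHugging (T : ForcedTower) : Prop :=
  ∃ (m r : ℕ) (H : (T.St m).IdealSheafData), CurveFrame H r (T.pt m) ∧ DivergentTowerClasses.HugsGerm T m H

variable {T} in
/-- bookkeeping: regular-curve hugging of the tower is `HugsRegCurve` of its branch. [folklore] -/
theorem hugsRegCurve_toBranch (h : RegularCurveHugging T) : (toBranch T g hB).HugsRegCurve := by
  obtain ⟨m, r, H, hF, hH⟩ := h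
  exact ⟨m, r, H, hF, (hugsGerm_toBranch T g hB m H).mpr hH⟩

/-- **LAW R — NO FORCED TOWER HUGS A REGULAR CURVE GERM: every weight `n`, every characteristic, every field, every class `P`.**
lens-6's regular-curve descent `hugsTop_of_hugsRegCurveN` (all markings; the followed orders are `n` by `tower_idealOrder_pt_eq`) BY NAME on
the branch of the tower, then the isolation kill `false_of_hugsTop`. [NEW] -/
theorem noTower_regularCurveHugging (n : ℕ) (P : ForcedTower → Prop) : NoTower n fun T => P T ∧ RegularCurveHugging T := by
  intro p _ k _ _ T g hB hD _ hR
  exact false_of_hugsTop T g hB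
    (hugsTop_of_hugsRegCurveN (toBranch T g hB) hD (tower_idealOrder_pt_eq T g hB hD) (hugsRegCurve_toBranch g hB hR.2))

/-- LAW R by name at every weight: `NoRegularCurveHuggingTowers`. -/
def NoRegularCurveHuggingTowers : Prop := ∀ n : ℕ, NoTower n RegularCurveHugging

/-- **LAW R, hypothesis-free, by name.** [NEW] -/
theorem noRegularCurveHuggingTowers_holds : NoRegularCurveHuggingTowers := fun n p hp k _ _ T g hB hD hE hR =>
  noTower_regularCurveHugging n (fun _ => True) p hp k T g hB hD hE ⟨trivial, hR⟩

end IsolationKill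

/-! ## §156 (g44 · THE PIGEONHOLE LAW) a branch hugging a one-dimensional germ hugs one of its PRIME COMPONENTS (paper STEP 1 of every
uniformization-of-a-curve proof; typed here for the first time).  Ring level along the followed points via the stalk formula
`stalkIdeal_strictTransformIdeal` (Literature/BlowupSNC): the stalk operator `stOp σ E 𝔞 = ⋃ₙ (𝔞·𝒪' : Eⁿ)` is monotone and super-multiplicative. -/

section StalkOperator

variable {A A' : Type*} [CommRing A] [CommRing A'] (σ : A →+* A') (E : Ideal A')

/-- **the ring-level strict-transform operator** `𝔞 ↦ ⋃ₙ (𝔞·A' : Eⁿ)` (the stalk of `strictTransformIdeal`, Literature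
`stalkIdeal_strictTransformIdeal`). -/
def stOp (𝔞 : Ideal A) : Ideal A' := ⨆ n : ℕ, Submodule.colon (𝔞.map σ) ((E ^ n : Ideal A') : Set A')

/-- `(x)·I ≤ N ↔ x ∈ (N : I)`. -/
theorem span_singleton_mul_le_iff_mem_colon (N I : Ideal A') (x : A') :
    Ideal.span {x} * I ≤ N ↔ x ∈ Submodule.colon N (I : Set A') := by
  rw [Ideal.span_singleton_mul_le_iff, Submodule.mem_colon]
  rfl

/-- the colon family is monotone in the exponent. [folklore] -/
theorem colon_pow_mono (N : Ideal A') : Monotone fun n : ℕ => Submodule.colon N ((E ^ n : Ideal A') : Set A') := by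
  intro a b hab x hx
  rw [← span_singleton_mul_le_iff_mem_colon] at hx ⊢
  exact le_trans (Ideal.mul_mono_right (Ideal.pow_le_pow_right hab)) hx

/-- membership: `x ∈ stOp σ E 𝔞 ↔ ∃ n, (x)·Eⁿ ⊆ 𝔞·A'`. [folklore] -/
theorem mem_stOp_iff {𝔞 : Ideal A} {x : A'} : x ∈ stOp σ E 𝔞 ↔ ∃ n : ℕ, Ideal.span {x} * E ^ n ≤ 𝔞.map σ := by
  unfold stOp
  rw [Submodule.mem_iSup_of_directed _ (colon_pow_mono E (𝔞.map σ)).directed_le]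
  simp only [span_singleton_mul_le_iff_mem_colon]

/-- monotone. [folklore] -/
theorem stOp_mono {𝔞 𝔟 : Ideal A} (h : 𝔞 ≤ 𝔟) : stOp σ E 𝔞 ≤ stOp σ E 𝔟 := by
  intro x hx
  rw [mem_stOp_iff] at hx ⊢
  obtain ⟨n, hn⟩ := hx
  exact ⟨n, hn.trans (Ideal.map_mono h)⟩

/-- `stOp ⊤ = ⊤`. [folklore] -/
theorem stOp_top : stOp σ E ⊤ = ⊤ := by
  rw [eq_top_iff]
  intro x _
  rw [mem_stOp_iff]
  exact ⟨0, by rw [Ideal.map_top]; exact le_top⟩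

/-- SUPER-MULTIPLICATIVE: `stOp 𝔞 · stOp 𝔟 ≤ stOp (𝔞𝔟)`. [folklore] -/
theorem stOp_mul_le (𝔞 𝔟 : Ideal A) : stOp σ E 𝔞 * stOp σ E 𝔟 ≤ stOp σ E (𝔞 * 𝔟) := by
  rw [Ideal.mul_le]
  intro r hr s hs
  rw [mem_stOp_iff] at hr hs ⊢
  obtain ⟨a, ha⟩ := hr
  obtain ⟨b, hb⟩ := hs
  refine ⟨a + b, ?_⟩
  rw [Ideal.map_mul, ← Ideal.span_singleton_mul_span_singleton, pow_add, mul_mul_mul_comm]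
  exact Ideal.mul_mono ha hb

/-- `(stOp 𝔞)^N ≤ stOp (𝔞^N)`. [folklore] -/
theorem stOp_pow_le (𝔞 : Ideal A) : ∀ N : ℕ, stOp σ E 𝔞 ^ N ≤ stOp σ E (𝔞 ^ N)
  | 0 => by rw [pow_zero, pow_zero, Ideal.one_eq_top, Ideal.one_eq_top, stOp_top]
  | N + 1 => by
    rw [pow_succ, pow_succ]
    exact le_trans (Ideal.mul_mono (stOp_pow_le 𝔞 N) le_rfl) (stOp_mul_le σ E _ _)

/-- `∏ stOp (𝔞 i) ≤ stOp (∏ 𝔞 i)`. [folklore] -/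
theorem prod_stOp_le {ι : Type*} (s : Finset ι) (𝔞 : ι → Ideal A) :
    ∏ i ∈ s, stOp σ E (𝔞 i) ≤ stOp σ E (∏ i ∈ s, 𝔞 i) := by
  classical
  induction s using Finset.induction_on with
  | empty => rw [Finset.prod_empty, Finset.prod_empty, Ideal.one_eq_top, Ideal.one_eq_top, stOp_top]
  | insert a s ha ih =>
    rw [Finset.prod_insert ha, Finset.prod_insert ha]
    exact le_trans (Ideal.mul_mono le_rfl ih) (stOp_mul_le σ E _ _)

end StalkOperator

section Pigeonhole

variable (B : SatelliteExitClasses.Branch k) (m : ℕ)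

/-- the followed stalk of the next strict transform is `stOp` of the followed stalk (Literature `stalkIdeal_strictTransformIdeal`,
at the point `π (pt (m+j+1))`). [folklore] -/
theorem stalkIdeal_strictIter_succ (K : (B.St m).IdealSheafData) (j : ℕ) :
    stalkIdeal (SatelliteExitClasses.strictIter B m K (j + 1)) (B.pt (m + j + 1)) =
      stOp ((B.π (m + j)).stalkMap (B.pt (m + j + 1))).hom (stalkIdeal ((B.centre (m + j)).comap (B.π (m + j))) (B.pt (m + j + 1)))
        (stalkIdeal (SatelliteExitClasses.strictIter B m K j) ((B.π (m + j)).base (B.pt (m + j + 1)))) := by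
  haveI := isLocallyNoetherian_St B (m + j + 1)
  show stalkIdeal (strictTransformIdeal (B.π (m + j)) (B.centre (m + j)) (SatelliteExitClasses.strictIter B m K j))
      (B.pt (m + j + 1)) = _
  rw [stalkIdeal_strictTransformIdeal]
  rfl

/-- SURVIVAL IS ANTITONE: if the followed point lies on the `(j+1)`-st strict transform it lies on the `j`-th. [folklore] -/
theorem mem_support_strictIter_of_succ (K : (B.St m).IdealSheafData) (j : ℕ)
    (h : B.pt (m + j + 1) ∈ (SatelliteExitClasses.strictIter B m K (j + 1)).support) :
    B.pt (m + j) ∈ (SatelliteExitClasses.strictIter B m K j).support := by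
  by_contra hne
  have htop : stalkIdeal (SatelliteExitClasses.strictIter B m K j) ((B.π (m + j)).base (B.pt (m + j + 1))) = ⊤ := by
    rw [B.pt_map (m + j)]; exact stalkIdeal_eq_top_of_not_mem_support hne
  have h1 := (mem_support_iff_stalkIdeal_le _ _).mp h
  rw [stalkIdeal_strictIter_succ, htop, stOp_top, top_le_iff] at h1
  exact (maximalIdeal.isMaximal _).ne_top h1

/-- survival is antitone (iterated). [folklore] -/
theorem mem_support_strictIter_of_le (K : (B.St m).IdealSheafData) {j j' : ℕ} (hjj : j ≤ j')
    (h : B.pt (m + j') ∈ (SatelliteExitClasses.strictIter B m K j').support) :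
    B.pt (m + j) ∈ (SatelliteExitClasses.strictIter B m K j).support := by
  induction hjj with
  | refl => exact h
  | step _ ih => exact ih (mem_support_strictIter_of_succ B m K _ h)

/-- THE PRODUCT INEQUALITY PROPAGATES: `(∏ᵢ (Kᵢ)ⱼ)^N ⊆ Hⱼ` at the followed points, all `j`. [folklore] -/
theorem prod_pow_le_strictIter {ι : Type*} (s : Finset ι) (Kc : ι → (B.St m).IdealSheafData) (H : (B.St m).IdealSheafData)
    (N : ℕ) (h0 : (∏ i ∈ s, stalkIdeal (Kc i) (B.pt m)) ^ N ≤ stalkIdeal H (B.pt m)) :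
    ∀ j, (∏ i ∈ s, stalkIdeal (SatelliteExitClasses.strictIter B m (Kc i) j) (B.pt (m + j))) ^ N ≤
      stalkIdeal (SatelliteExitClasses.strictIter B m H j) (B.pt (m + j))
  | 0 => h0
  | j + 1 => by
    have ih : (∏ i ∈ s, stalkIdeal (SatelliteExitClasses.strictIter B m (Kc i) j) ((B.π (m + j)).base (B.pt (m + j + 1)))) ^ N ≤
        stalkIdeal (SatelliteExitClasses.strictIter B m H j) ((B.π (m + j)).base (B.pt (m + j + 1))) := by
      rw [B.pt_map (m + j)]; exact prod_pow_le_strictIter s Kc H N h0 j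
    show (∏ i ∈ s, stalkIdeal (SatelliteExitClasses.strictIter B m (Kc i) (j + 1)) (B.pt (m + j + 1))) ^ N ≤
      stalkIdeal (SatelliteExitClasses.strictIter B m H (j + 1)) (B.pt (m + j + 1))
    rw [stalkIdeal_strictIter_succ, Finset.prod_congr rfl fun i _ => stalkIdeal_strictIter_succ B m (Kc i) j]
    refine le_trans (Ideal.pow_right_mono (prod_stOp_le _ _ s _) N) ?_
    exact le_trans (stOp_pow_le _ _ _ N) (stOp_mono _ _ ih)

/-- the germ sheaf of a prime of the local ring at `pt m`: the vanishing ideal of the closure of the corresponding generisation. -/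
def primeGerm (q : PrimeSpectrum ((B.St m).presheaf.stalk (B.pt m))) : (B.St m).IdealSheafData :=
  Scheme.IdealSheafData.vanishingIdeal ⟨closure {(B.St m).fromSpecStalk (B.pt m) q}, isClosed_closure⟩

/-- its stalk at `pt m` is the prime. [folklore] -/
theorem stalkIdeal_primeGerm (q : PrimeSpectrum ((B.St m).presheaf.stalk (B.pt m))) :
    stalkIdeal (primeGerm B m q) (B.pt m) = q.asIdeal := by
  unfold primeGerm
  rw [stalkIdeal_vanishingIdeal_closure (fromSpecStalk_specializes q), primeOfSpecializes_fromSpecStalk]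

/-- **THE PIGEONHOLE LAW.**  If the branch hugs a germ `V(H) ∋ pt m` then it hugs the germ of one of the MINIMAL PRIMES of `H_{pt m}`:
`(∏ Pᵢ)^N ⊆ H_{pt m}` (Noetherian), the product inequality propagates along the strict transforms (`stOp` is monotone and
super-multiplicative), so at every stage SOME `Pᵢ`-germ passes through the followed point (prime avoidance), survival is antitone, and a
finite set of candidates one of which survives every stage has a member surviving all stages. [NEW] -/
theorem exists_hugsGerm_minimalPrime {H : (B.St m).IdealSheafData} (hH : SatelliteExitClasses.HugsGerm B m H) :
    ∃ q : PrimeSpectrum ((B.St m).presheaf.stalk (B.pt m)), q.asIdeal ∈ (stalkIdeal H (B.pt m)).minimalPrimes ∧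
      SatelliteExitClasses.HugsGerm B m (primeGerm B m q) := by
  classical
  haveI := isLocallyNoetherian_St B m
  haveI : IsRegularLocalRing ((B.St m).presheaf.stalk (B.pt m)) := (B.base m).isRegular _
  set I := stalkIdeal H (B.pt m) with hI
  have hIle : I ≤ maximalIdeal _ := (mem_support_iff_stalkIdeal_le _ _).mp (hH.2 0)
  have hIne : I ≠ ⊥ := fun h0 => hH.1 (idealOrder_eq_top_of_stalkIdeal_eq_bot' _ _ h0)
  -- the finite set of minimal primes, as points of the prime spectrum
  have hfin : ((fun q : PrimeSpectrum ((B.St m).presheaf.stalk (B.pt m)) => q.asIdeal) ⁻¹' I.minimalPrimes).Finite :=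
    (Ideal.finite_minimalPrimes_of_isNoetherianRing _ I).preimage fun _ _ _ _ h => PrimeSpectrum.ext h
  set s : Finset (PrimeSpectrum ((B.St m).presheaf.stalk (B.pt m))) := hfin.toFinset with hs
  have hmem_s : ∀ q, q ∈ s ↔ q.asIdeal ∈ I.minimalPrimes := fun q => by rw [hs, Set.Finite.mem_toFinset]; rfl
  -- `(∏_{q ∈ s} q)^N ≤ I`
  obtain ⟨N₀, hN₀⟩ := Ideal.exists_radical_pow_le_of_fg I (IsNoetherian.noetherian _)
  set N := N₀ + 1 with hN
  have hprod : (∏ q ∈ s, q.asIdeal) ≤ I.radical := by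
    rw [← Ideal.sInf_minimalPrimes]
    refine le_sInf fun P hP => ?_
    have hq : (⟨P, hP.1.1⟩ : PrimeSpectrum _) ∈ s := (hmem_s _).mpr hP
    exact le_trans Ideal.prod_le_inf (Finset.inf_le hq)
  have h0 : (∏ q ∈ s, stalkIdeal (primeGerm B m q) (B.pt m)) ^ N ≤ stalkIdeal H (B.pt m) := by
    rw [Finset.prod_congr rfl fun q _ => stalkIdeal_primeGerm B m q]
    exact le_trans (Ideal.pow_right_mono hprod N) (le_trans (Ideal.pow_le_pow_right (Nat.le_succ N₀)) hN₀)
  have hall := prod_pow_le_strictIter B m s (fun q => primeGerm B m q) H N h0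
  -- at every stage some candidate passes through the followed point
  have hstage : ∀ j, ∃ q ∈ s, B.pt (m + j) ∈ (SatelliteExitClasses.strictIter B m (primeGerm B m q) j).support := by
    intro j
    have h1 : (∏ q ∈ s, stalkIdeal (SatelliteExitClasses.strictIter B m (primeGerm B m q) j) (B.pt (m + j))) ^ N ≤
        maximalIdeal _ := le_trans (hall j) ((mem_support_iff_stalkIdeal_le _ _).mp (hH.2 j))
    rw [Ideal.IsPrime.pow_le_iff (Nat.succ_ne_zero N₀), Ideal.IsPrime.prod_le inferInstance] at h1
    obtain ⟨q, hq, hle⟩ := h1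
    exact ⟨q, hq, (mem_support_iff_stalkIdeal_le _ _).mpr hle⟩
  -- pigeonhole over the finite set `s`
  by_contra hcon
  push Not at hcon
  have hcon' : ∀ q ∈ s, ∃ j, B.pt (m + j) ∉ (SatelliteExitClasses.strictIter B m (primeGerm B m q) j).support := by
    intro q hq
    have h1 := hcon q ((hmem_s q).mp hq)
    unfold SatelliteExitClasses.HugsGerm at h1
    push Not at h1
    refine h1 ?_
    have hqI : I ≤ q.asIdeal := ((hmem_s q).mp hq).1.2
    have hqne : q.asIdeal ≠ ⊥ := fun h => hIne (le_bot_iff.mp (h ▸ hqI))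
    exact (idealOrder_lt_top_of_stalkIdeal_ne_bot (by rw [stalkIdeal_primeGerm]; exact hqne)).ne
  choose! jf hjf using hcon'
  obtain ⟨q, hq, hmem⟩ := hstage (s.sup jf)
  exact hjf q hq (mem_support_strictIter_of_le B m _ (Finset.le_sup hq) hmem)

end Pigeonhole

end Summit.ResolutionOfSingularities.ResolutionOfSingularities.Theorems.HugValuationCut
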